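import Literature.NumberTheory.LFunctions.MoebiusAutomaticFinalSyncPrep
import HarnessLib

/-!
# Müllner's theorem for automata whose final components are synchronizing (Prop. 3.3 with trivial transducer group; proved)

Everything in this file is PROVED. It formalises the reduction Prop. 3.2 ⇒ Thm. 1.2 of
C. Müllner, *Automatic sequences fulfill the Sarnak conjecture* (Duke Math. J. 166 (2017)),
§3.1, in the case where all the naturally induced transducers are trivial (`n₀(A_i) = 1` for
every final component, `G = {id}`, only the trivial representation `D₀`), i.e. for DFAOs all of
whose final strongly connected components are synchronizing; in that case Prop. 3.2 reduces to
"`μ` is `o(N)` on arithmetic progressions intersected with intervals", which the tree has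
(`exists_forall_norm_sum_Ico_residue_moebius_le`, from the Siegel–Walfisz theorem for `μ`), so
the result is unconditional:

> (`isLittleO_moebiusSum_dfaoSeq_of_finalSync`) Let `k ≥ 2` and let `(σ, δ, q₀, τ)` be a DFAO
> with finitely many states read from the most significant digit, `δ(q₀, 0) = q₀`. Let `F ⊆ σ`
> be closed under the digit transitions, reachable from every state by some digit word, and
> synchronized by a digit word `w` in the sense `δ(q, u w) = δ(q, w)` for all `q ∈ F` and all
> digit words `u` (for `F` = the union of the final components: every final component is
> synchronizing). Then `∑_{n ≤ N} τ(δ(q₀,(n)_k)) μ(n) = o(N)`.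

`isLittleO_moebiusSum_dfaoSeq_of_finalSync'` removes the normalisation `δ(q₀, 0) = q₀`
(`dfaoSeq_optionLift`). This contains the synchronizing case
(`MoebiusAutomaticSynchronizing.lean`, `F = σ`) and, at the other end, sequences such as
"the leading digit of `n`" whose final components are single absorbing states.

Proof (Müllner §3.1 with `D` trivial): with `k^{ν−1} ≤ N < k^ν`, pad `n ≤ N` to `ν` digits;
fix the first `λ₁` digits `b = ⌊n/k^{ν−λ₁}⌋` and the last `λ₂` digits `m = n mod k^{λ₂}`. Off
the bad prefixes (`enterBad`, proportion `≤ η₁`, Lemma setDens) the state after `b` lies in `F`;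
off the bad suffixes (`syncBad`, proportion `≤ η₂`) the suffix contains `w`, so by the
synchronizing property `a_n = Φ(b, m)` (`dfaoSeq_eq_of_good`). Hence
`∑_{n≤N} a_n μ(n) = ∑_{b,m} Φ(b,m) ∑_{n ≤ N : prefix b, n ≡ m} μ(n) + O(B(η₁ k + 2η₂) N)`, and each
inner sum is a Möbius sum over an interval in a progression, `≤ ε₃ N` uniformly; there are at
most `k^{λ₁+λ₂}` of them.

## References
* C. Müllner, Duke Math. J. 166 (2017), §3.1, Prop. 3.3 (and Lemma setDens, §5.1). [Mullner2017]
-/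

noncomputable section

open Finset Filter Asymptotics
open scoped ArithmeticFunction.Moebius

namespace Literature.NumberTheory.LFunctions

section Main

variable {σ : Type*}

/-- Counting integers `n ≤ N` by their quotient: `#{n ≤ N : ⌊n/D⌋ ∈ S} ≤ #S · D`. [folklore] -/
theorem card_filter_div_mem_le (D : ℕ) (hD : 0 < D) (S : Finset ℕ) (N : ℕ) :
    ((range (N + 1)).filter fun n => n / D ∈ S).card ≤ S.card * D := by
  calc ((range (N + 1)).filter fun n => n / D ∈ S).card ≤ (S ×ˢ range D).card := by
        refine card_le_card_of_injOn (fun n => (n / D, n % D)) (fun n hn => ?_) ?_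
        · rw [mem_coe, mem_filter] at hn
          simp only [mem_coe, mem_product, mem_range]
          exact ⟨hn.2, Nat.mod_lt _ hD⟩
        · intro n₁ _ n₂ _ h
          simp only [Prod.mk.injEq] at h
          rw [← Nat.div_add_mod n₁ D, ← Nat.div_add_mod n₂ D, h.1, h.2]
    _ = S.card * D := by rw [card_product, card_range]

/-- `n / D = b` cuts out the interval `[bD, (b+1)D)`: the filtered sum over `n ≤ N` is the sum
over `Ico (bD) (min ((b+1)D) (N+1))`. [folklore] -/
theorem sum_filter_div_eq_eq_sum_Ico {D : ℕ} (hD : 0 < D) (b N : ℕ) (f : ℕ → ℂ) :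
    ∑ n ∈ (range (N + 1)).filter (fun n => n / D = b), f n =
      ∑ n ∈ Ico (b * D) (min ((b + 1) * D) (N + 1)), f n := by
  have key : ∀ n, n / D = b ↔ b * D ≤ n ∧ n < (b + 1) * D := fun n => by
    rw [← Nat.le_div_iff_mul_le hD, ← Nat.div_lt_iff_lt_mul hD]; omega
  refine sum_congr ?_ fun _ _ => rfl
  ext n
  simp only [mem_filter, mem_range, mem_Ico, lt_min_iff, key]
  tauto

/-- **The key identity** (Müllner §3.1: after a good prefix the state is in a final component,
and a synchronizing suffix then determines the state): for `n < k^ν`, `λ₁ + λ₂ ≤ ν`, if the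
first `λ₁` digits `b = ⌊n / k^{ν−λ₁}⌋` of the padded word lead into `F` and the last `λ₂` digits
`m = n mod k^{λ₂}` contain `w`, then `a_n = τ(δ(δ(q₀,(b)_k^{λ₁}), w (m)_k^{λ₂}))`.
[cite: Mullner2017, §3.1] -/
theorem dfaoSeq_eq_of_good {k : ℕ} (hk : 1 < k) {δ : σ → ℕ → σ} {q₀ : σ} (h0 : δ q₀ 0 = q₀)
    (τ : σ → ℂ) {F : Set σ} {w : List ℕ} (hw : ∀ d ∈ w, d < k)
    (hsync : ∀ q ∈ F, ∀ u : List ℕ, (∀ d ∈ u, d < k) → (u ++ w).foldl δ q = w.foldl δ q)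
    {l1 l2 ν : ℕ} (hν : l1 + l2 ≤ ν) {n : ℕ} (hn : n < k ^ ν)
    (htop : n / k ^ (ν - l1) ∉ enterBad k δ q₀ F l1) (hbot : n % k ^ l2 ∉ syncBad k l2 w) :
    dfaoSeq k δ q₀ τ n =
      τ ((w ++ msbBlock k l2 (n % k ^ l2)).foldl δ ((msbBlock k l1 (n / k ^ (ν - l1))).foldl δ q₀)) := by
  have hk0 : 0 < k := by omega
  obtain ⟨mid, hmid⟩ : ∃ mid, ν - l1 = mid + l2 ∧ ν = l1 + (mid + l2) :=
    ⟨ν - l1 - l2, by omega, by omega⟩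
  rw [hmid.1] at htop ⊢
  set T := n / k ^ (mid + l2) with hT_def
  set R := n % k ^ (mid + l2) with hR_def
  have hDpos : 0 < k ^ (mid + l2) := pow_pos hk0 _
  have hK2pos : 0 < k ^ l2 := pow_pos hk0 _
  have hT : T < k ^ l1 := by
    rw [hT_def, Nat.div_lt_iff_lt_mul hDpos, ← pow_add, ← hmid.2]
    exact hn
  have hR : R < k ^ (mid + l2) := Nat.mod_lt _ hDpos
  set Mid := R / k ^ l2 with hMid_def
  have hMid : Mid < k ^ mid := by
    rw [hMid_def, Nat.div_lt_iff_lt_mul hK2pos, ← pow_add]; exact hR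
  have hBt : R % k ^ l2 = n % k ^ l2 :=
    Nat.mod_mod_of_dvd n (pow_dvd_pow k (Nat.le_add_left l2 mid))
  have hBtlt : n % k ^ l2 < k ^ l2 := Nat.mod_lt _ hK2pos
  -- the padded word splits into three blocks
  have hsplit : msbBlock k ν n =
      msbBlock k l1 T ++ (msbBlock k mid Mid ++ msbBlock k l2 (n % k ^ l2)) := by
    have h1 : n = k ^ (mid + l2) * T + R := (Nat.div_add_mod n _).symm
    have h2 : R = k ^ l2 * Mid + R % k ^ l2 := (Nat.div_add_mod R _).symm
    conv_lhs => rw [hmid.2, h1]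
    rw [msbBlock_add hk hT hR, ← hBt]
    conv_lhs => rw [h2]
    rw [msbBlock_add hk hMid (Nat.mod_lt _ hK2pos)]
  -- the state after the top block is in `F`; the bottom block contains `w`
  have hp : (msbBlock k l1 T).foldl δ q₀ ∈ F := by
    by_contra h
    exact htop (mem_enterBad.2 ⟨hT, h⟩)
  have hwBt : w <:+: msbBlock k l2 (n % k ^ l2) := by
    by_contra h
    exact hbot (mem_syncBad.2 ⟨hBtlt, h⟩)
  obtain ⟨x, v, hxv⟩ := hwBt
  have hx : ∀ d ∈ x, d < k := fun d hd =>
    lt_of_mem_msbBlock hk (hxv ▸ List.mem_append_left _ (List.mem_append_left _ hd))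
  rw [dfaoSeq_eq_of_fix_zero h0 k ν, hsplit, List.foldl_append, ← hxv]
  set p := (msbBlock k l1 T).foldl δ q₀
  have hMx : ∀ d ∈ msbBlock k mid Mid ++ x, d < k := fun d hd => by
    rcases List.mem_append.1 hd with h | h
    · exact lt_of_mem_msbBlock hk h
    · exact hx d h
  have hwx : ∀ d ∈ w ++ x, d < k := fun d hd => by
    rcases List.mem_append.1 hd with h | h
    · exact hw d h
    · exact hx d h
  have hL : (msbBlock k mid Mid ++ (x ++ w ++ v)).foldl δ p = v.foldl δ (w.foldl δ p) := by
    rw [show msbBlock k mid Mid ++ (x ++ w ++ v) = ((msbBlock k mid Mid ++ x) ++ w) ++ v by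
      simp [List.append_assoc], List.foldl_append, hsync p hp _ hMx]
  have hR' : (w ++ (x ++ w ++ v)).foldl δ p = v.foldl δ (w.foldl δ p) := by
    rw [show w ++ (x ++ w ++ v) = ((w ++ x) ++ w) ++ v by simp [List.append_assoc],
      List.foldl_append, hsync p hp _ hwx]
  rw [hL, hR']

/-- Evaluation of the double indicator sum defining the structured model. [folklore] -/
theorem sum_sum_mul_ite_ite (GT GB : Finset ℕ) (Φ : ℕ → ℕ → ℂ) (x y : ℕ) :
    ∑ b ∈ GT, ∑ r ∈ GB, Φ b r * ((if x = b then (1 : ℂ) else 0) * (if y = r then 1 else 0)) =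
      if x ∈ GT ∧ y ∈ GB then Φ x y else 0 := by
  have : ∀ b ∈ GT, ∑ r ∈ GB, Φ b r * ((if x = b then (1 : ℂ) else 0) * (if y = r then 1 else 0))
      = if x = b then (if y ∈ GB then Φ b y else 0) else 0 := by
    intro b _
    by_cases hb : x = b
    · simp only [hb, if_true, mul_ite, mul_one, mul_zero]
      rw [sum_ite_eq]
    · simp [hb]
  rw [sum_congr rfl this, sum_ite_eq]
  by_cases h1 : x ∈ GT <;> by_cases h2 : y ∈ GB <;> simp [h1, h2]

/-- **Müllner's theorem for DFAOs whose final components are synchronizing** (Müllner 2017,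
Prop. 3.3 ⇒ Thm. 1.2 in the case of trivial naturally induced transducers, made unconditional by
the Siegel–Walfisz theorem for `μ`), normalised form `δ(q₀, 0) = q₀`: see the module docstring.
[cite: Mullner2017, Prop. 3.3 (case G trivial)] -/
theorem isLittleO_moebiusSum_dfaoSeq_of_finalSync [Finite σ] {k : ℕ} (hk : 2 ≤ k)
    (δ : σ → ℕ → σ) (q₀ : σ) (τ : σ → ℂ) (h0 : δ q₀ 0 = q₀) {F : Set σ}
    (hF : ∀ q ∈ F, ∀ d, d < k → δ q d ∈ F)
    (hreach : ∀ q : σ, ∃ u : List ℕ, (∀ d ∈ u, d < k) ∧ u.foldl δ q ∈ F)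
    {w : List ℕ} (hw : ∀ d ∈ w, d < k)
    (hsync : ∀ q ∈ F, ∀ u : List ℕ, (∀ d ∈ u, d < k) → (u ++ w).foldl δ q = w.foldl δ q) :
    moebiusSum (dfaoSeq k δ q₀ τ) =o[atTop] fun N : ℕ => (N : ℝ) := by
  have hk1 : 1 < k := hk
  have hk0 : 0 < k := by omega
  haveI := Fintype.ofFinite σ
  -- a uniform bound for the values
  set B : ℝ := 1 + ∑ q, ‖τ q‖
  have hB0 : 0 < B := by
    have : 0 ≤ ∑ q, ‖τ q‖ := sum_nonneg fun _ _ => norm_nonneg _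
    linarith
  have hτ : ∀ q, ‖τ q‖ ≤ B := fun q =>
    (single_le_sum (f := fun q => ‖τ q‖) (fun _ _ => norm_nonneg _) (mem_univ q)).trans
      (by linarith)
  set a := dfaoSeq k δ q₀ τ with ha_def
  have ha : ∀ n, ‖a n‖ ≤ B := fun n => hτ _
  rw [isLittleO_iff]
  intro ε hε
  have hkR : (0 : ℝ) < k := by exact_mod_cast hk0
  -- the levels `λ₁`, `λ₂` and the threshold
  obtain ⟨m, hm⟩ := exists_uniform_enter hk1.le hF hreach
  obtain ⟨l1, hl1⟩ := exists_card_le_of_card_mul_le hk1 (S := fun L => enterBad k δ q₀ F L)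
    (card_enterBad_mul_le hk1 hF hm) (η := ε / (8 * B * k)) (by positivity)
  obtain ⟨l2, hl2⟩ := exists_card_syncBad_le hk1 hw (η := ε / (16 * B)) (by positivity)
  set K1 := k ^ l1 with hK1
  set K2 := k ^ l2 with hK2
  have hK1pos : 0 < K1 := pow_pos hk0 _
  have hK2pos : 0 < K2 := pow_pos hk0 _
  have hK1R : (0 : ℝ) < K1 := by exact_mod_cast hK1pos
  have hK2R : (0 : ℝ) < K2 := by exact_mod_cast hK2pos
  obtain ⟨N₃, hN₃⟩ := exists_forall_norm_sum_Ico_residue_moebius_le hK2pos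
    (ε := ε / (8 * B * K1 * K2)) (by positivity)
  refine eventually_atTop.2 ⟨max N₃ (k ^ (l1 + l2)), fun N hN => ?_⟩
  have hN3 : N₃ ≤ N := (le_max_left _ _).trans hN
  have hNpow : k ^ (l1 + l2) ≤ N := (le_max_right _ _).trans hN
  have hNpos : 0 < N := lt_of_lt_of_le (pow_pos hk0 _) hNpow
  have hK2N : K2 ≤ N := (Nat.pow_le_pow_right hk0 (Nat.le_add_left l2 l1)).trans hNpow
  rw [Real.norm_natCast]
  -- `ν` digits: `k^{ν-1} ≤ N < k^ν`
  set ν := (Nat.digits k N).length with hν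
  have hNν : N < k ^ ν := Nat.lt_base_pow_length_digits hk1
  have hνN : k ^ ν ≤ k * N := Nat.base_pow_length_digits_le k N hk1 hNpos.ne'
  have hl12 : l1 + l2 ≤ ν :=
    ((Nat.pow_lt_pow_iff_right hk1).1 (lt_of_le_of_lt hNpow hNν)).le
  set D := k ^ (ν - l1) with hD
  have hDpos : 0 < D := pow_pos hk0 _
  have hK1D : (K1 : ℝ) * D ≤ k * N := by
    have : K1 * D = k ^ ν := by rw [hK1, hD, ← pow_add]; congr 1; omega
    exact_mod_cast this.le.trans hνN
  -- the structured model `c`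
  set Φ : ℕ → ℕ → ℂ := fun b r =>
    τ ((w ++ msbBlock k l2 r).foldl δ ((msbBlock k l1 b).foldl δ q₀)) with hΦ
  have hΦB : ∀ b r, ‖Φ b r‖ ≤ B := fun b r => hτ _
  set GT := (range K1).filter fun b => b ∉ enterBad k δ q₀ F l1 with hGT
  set GB := (range K2).filter fun r => r ∉ syncBad k l2 w with hGB
  set c : ℕ → ℂ := fun n => ∑ b ∈ GT, ∑ r ∈ GB,
    Φ b r * ((if n / D = b then (1 : ℂ) else 0) * (if n % K2 = r then 1 else 0)) with hc
  have hc_eval : ∀ n, c n = if n / D ∈ GT ∧ n % K2 ∈ GB then Φ (n / D) (n % K2) else 0 :=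
    fun n => sum_sum_mul_ite_ite GT GB Φ (n / D) (n % K2)
  -- (1) pointwise comparison for `n ≤ N`
  have hptwise : ∀ n, n < N + 1 → ‖a n - c n‖ ≤
      (if n / D ∈ enterBad k δ q₀ F l1 then B else 0) +
        (if n % K2 ∈ syncBad k l2 w then B else 0) := by
    intro n hn
    have hnν : n < k ^ ν := lt_of_le_of_lt (Nat.le_of_lt_succ hn) hNν
    have hnD : n / D < K1 := by
      rw [Nat.div_lt_iff_lt_mul hDpos, hK1, hD, ← pow_add]
      calc n < k ^ ν := hnν
        _ = k ^ (l1 + (ν - l1)) := by congr 1; omega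
    by_cases h1 : n / D ∈ enterBad k δ q₀ F l1
    · rw [if_pos h1]
      have : c n = 0 := by
        rw [hc_eval, if_neg]
        rintro ⟨hT, -⟩
        exact (mem_filter.1 hT).2 h1
      rw [this, sub_zero]
      have : 0 ≤ (if n % K2 ∈ syncBad k l2 w then B else 0) := by split_ifs <;> linarith
      linarith [ha n]
    · rw [if_neg h1, zero_add]
      by_cases h2 : n % K2 ∈ syncBad k l2 w
      · rw [if_pos h2]
        have : c n = 0 := by
          rw [hc_eval, if_neg]
          rintro ⟨-, hB'⟩
          exact (mem_filter.1 hB').2 h2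
        rw [this, sub_zero]
        exact ha n
      · rw [if_neg h2]
        have hcn : c n = Φ (n / D) (n % K2) := by
          rw [hc_eval, if_pos]
          exact ⟨mem_filter.2 ⟨mem_range.2 hnD, h1⟩,
            mem_filter.2 ⟨mem_range.2 (Nat.mod_lt _ hK2pos), h2⟩⟩
        have han : a n = Φ (n / D) (n % K2) :=
          dfaoSeq_eq_of_good hk1 h0 τ hw hsync hl12 hnν h1 h2
        rw [hcn, han, sub_self, norm_zero]
  -- (2) the `L¹` error
  have hL1 : ∑ n ∈ range (N + 1), ‖a n - c n‖ ≤ ε / 4 * N := by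
    calc ∑ n ∈ range (N + 1), ‖a n - c n‖
        ≤ ∑ n ∈ range (N + 1), ((if n / D ∈ enterBad k δ q₀ F l1 then B else 0) +
            (if n % K2 ∈ syncBad k l2 w then B else 0)) :=
          sum_le_sum fun n hn => hptwise n (mem_range.1 hn)
      _ = B * ((range (N + 1)).filter fun n => n / D ∈ enterBad k δ q₀ F l1).card +
            B * ((range (N + 1)).filter fun n => n % K2 ∈ syncBad k l2 w).card := by
          rw [sum_add_distrib, ← sum_filter, ← sum_filter, sum_const, sum_const, nsmul_eq_mul,
            nsmul_eq_mul, mul_comm _ B, mul_comm _ B]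
      _ ≤ B * ((enterBad k δ q₀ F l1).card * D) + B * ((N / K2 + 1 : ℕ) * (syncBad k l2 w).card) := by
          gcongr
          · exact_mod_cast card_filter_div_mem_le D hDpos _ N
          · exact_mod_cast card_filter_mod_mem_le K2 _ N
      _ ≤ B * (ε / (8 * B * k) * K1 * D) + B * ((N / K2 + 1 : ℕ) * (ε / (16 * B) * K2)) := by
          have hl1' : ((enterBad k δ q₀ F l1).card : ℝ) ≤ ε / (8 * B * k) * (K1 : ℝ) := by
            rw [hK1]; push_cast; exact hl1
          have hl2' : ((syncBad k l2 w).card : ℝ) ≤ ε / (16 * B) * (K2 : ℝ) := by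
            rw [hK2]; push_cast; exact hl2
          gcongr
      _ ≤ ε / 4 * N := by
          have h1 : B * (ε / (8 * B * k) * K1 * D) ≤ ε / 8 * N := by
            have : B * (ε / (8 * B * k) * K1 * D) = ε / 8 * ((K1 : ℝ) * D / k) := by
              field_simp
            rw [this]
            gcongr
            rw [div_le_iff₀ hkR, mul_comm (N : ℝ)]
            exact hK1D
          have h2 : B * (((N / K2 + 1 : ℕ) : ℝ) * (ε / (16 * B) * K2)) ≤ ε / 8 * N := by
            have hq : ((N / K2 + 1 : ℕ) : ℝ) * K2 ≤ 2 * N := by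
              have h' : (N / K2 + 1) * K2 ≤ 2 * N := by
                calc (N / K2 + 1) * K2 = N / K2 * K2 + K2 := by ring
                  _ ≤ N + N := add_le_add (Nat.div_mul_le_self N K2) hK2N
                  _ = 2 * N := by ring
              exact_mod_cast h'
            calc B * (((N / K2 + 1 : ℕ) : ℝ) * (ε / (16 * B) * K2))
                = ε / 16 * ((((N / K2 + 1 : ℕ) : ℝ)) * K2) := by field_simp
              _ ≤ ε / 16 * (2 * N) := by gcongr
              _ = ε / 8 * N := by ring
          linarith
  -- (3) the structured part: intervals in progressions
  have hMc : ‖moebiusSum c N‖ ≤ ε / 8 * N := by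
    have hexp : moebiusSum c N = ∑ b ∈ GT, ∑ r ∈ GB, Φ b r *
        ∑ n ∈ Ico (b * D) (min ((b + 1) * D) (N + 1)),
          (if n % K2 = r then (1 : ℂ) else 0) * (μ n : ℂ) := by
      rw [hc, moebiusSum_finset_sum]
      refine sum_congr rfl fun b _ => ?_
      rw [moebiusSum_finset_sum]
      refine sum_congr rfl fun r _ => ?_
      rw [moebiusSum_const_mul, moebiusSum, ← sum_filter_div_eq_eq_sum_Ico hDpos, sum_filter]
      congr 1
      refine sum_congr rfl fun n _ => ?_
      split_ifs <;> simp
    rw [hexp]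
    calc ‖∑ b ∈ GT, ∑ r ∈ GB, Φ b r * ∑ n ∈ Ico (b * D) (min ((b + 1) * D) (N + 1)),
            (if n % K2 = r then (1 : ℂ) else 0) * (μ n : ℂ)‖
        ≤ ∑ b ∈ GT, ∑ r ∈ GB, B * (ε / (8 * B * K1 * K2) * N) := by
          refine (norm_sum_le _ _).trans (sum_le_sum fun b _ => ?_)
          refine (norm_sum_le _ _).trans (sum_le_sum fun r _ => ?_)
          rw [norm_mul]
          exact mul_le_mul (hΦB b r) (hN₃ N hN3 r _ _ (min_le_right _ _)) (norm_nonneg _)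
            (by linarith)
      _ = (GT.card : ℝ) * (GB.card * (B * (ε / (8 * B * K1 * K2) * N))) := by
          rw [sum_const, sum_const, nsmul_eq_mul, nsmul_eq_mul]
      _ ≤ (K1 : ℝ) * (K2 * (B * (ε / (8 * B * K1 * K2) * N))) := by
          have hGT : (GT.card : ℝ) ≤ K1 := by
            exact_mod_cast (card_filter_le _ _).trans_eq (card_range K1)
          have hGB : (GB.card : ℝ) ≤ K2 := by
            exact_mod_cast (card_filter_le _ _).trans_eq (card_range K2)
          gcongr
      _ = ε / 8 * N := by field_simp
  -- conclusion
  calc ‖moebiusSum a N‖ = ‖(moebiusSum a N - moebiusSum c N) + moebiusSum c N‖ := by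
        rw [sub_add_cancel]
    _ ≤ ‖moebiusSum a N - moebiusSum c N‖ + ‖moebiusSum c N‖ := norm_add_le _ _
    _ ≤ ε / 4 * N + ε / 8 * N := add_le_add ((norm_moebiusSum_sub_le a c N).trans hL1) hMc
    _ ≤ ε * N := by
        have : (0 : ℝ) ≤ N := Nat.cast_nonneg N
        nlinarith

/-- **Müllner's theorem for DFAOs whose final components are synchronizing**, general form
(no normalisation of the initial state; via `dfaoSeq_optionLift`). For `F` the union of the
final strongly connected components the hypotheses say: every final component is synchronizing
(a common word `w` synchronizes each of them). [cite: Mullner2017, Prop. 3.3 (case G trivial)] -/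
theorem isLittleO_moebiusSum_dfaoSeq_of_finalSync' [Finite σ] {k : ℕ} (hk : 2 ≤ k)
    (δ : σ → ℕ → σ) (q₀ : σ) (τ : σ → ℂ) {F : Set σ}
    (hF : ∀ q ∈ F, ∀ d, d < k → δ q d ∈ F)
    (hreach : ∀ q : σ, ∃ u : List ℕ, (∀ d ∈ u, d < k) ∧ u.foldl δ q ∈ F)
    {w : List ℕ} (hw : ∀ d ∈ w, d < k)
    (hsync : ∀ q ∈ F, ∀ u : List ℕ, (∀ d ∈ u, d < k) → (u ++ w).foldl δ q = w.foldl δ q) :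
    moebiusSum (dfaoSeq k δ q₀ τ) =o[atTop] fun N : ℕ => (N : ℝ) := by
  rw [← dfaoSeq_optionLift k δ q₀ τ]
  refine isLittleO_moebiusSum_dfaoSeq_of_finalSync hk (optionLiftδ δ q₀) none (optionLiftτ τ q₀)
    (optionLiftδ_none_zero δ q₀) (F := some '' F) ?_ ?_ hw ?_
  · rintro _ ⟨q, hq, rfl⟩ d hd
    exact ⟨δ q d, hF q hq d hd, rfl⟩
  · rintro (_ | q)
    · obtain ⟨u, hu, huF⟩ := hreach (δ q₀ 1)
      refine ⟨1 :: u, ?_, ?_⟩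
      · intro d hd
        rcases List.mem_cons.1 hd with rfl | h
        · exact hk
        · exact hu d h
      · rw [List.foldl_cons]
        have : optionLiftδ δ q₀ none 1 = some (δ q₀ 1) := by simp [optionLiftδ]
        rw [this, foldl_optionLiftδ_some]
        exact ⟨_, huF, rfl⟩
    · obtain ⟨u, hu, huF⟩ := hreach q
      exact ⟨u, hu, by rw [foldl_optionLiftδ_some]; exact ⟨_, huF, rfl⟩⟩
  · rintro _ ⟨q, hq, rfl⟩ u hu
    rw [foldl_optionLiftδ_some, foldl_optionLiftδ_some, hsync q hq u hu]

end Main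

end Literature.NumberTheory.LFunctions
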